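import Summits.Schanuel.Schanuel.Theorems.ZilberEacMonicCurvePolyFibres
import Summits.Schanuel.Schanuel.Theorems.ZilberEacCyclicCoverSheetFibres
import HarnessLib

/-!
# Arbitrary base branches, LVI: RATIONAL fibres `y₀ = R(x)/Q(x)` — every nonzero rational function
# on the base curve — along a good place; every cyclic cover `x₁^k = P(x₀)`, `k ≥ 3`

HONEST FRAMING.  Cell `pub-schanuel` (Zilber's Exponential-Algebraic Closedness, case ladder;
host summit Schanuel), seat 2, gen 30.  The normal-form method of files LIII–LIV is insensitive to
division: if `R` and `Q` are both nonzero somewhere on the monic irreducible curve `C : F = 0`, their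
values along a place at infinity are `ψ_R(s)s^{L_R}` and `ψ_Q(s)s^{L_Q}` (file LIV), so the rational
fibre value `R/Q` is `ψ(s)s^{L}` with `ψ = ψ_R/ψ_Q` analytic, `ψ(0) ≠ 0`, `L = L_R − L_Q ∈ ℤ`, and the
pole-fibre engine of file XXXII applies in a good direction.  Results (density for EVERY irreducible
surface `S` of dimension `≤ 2` containing the graph of `R/Q` over `C` off the poles):
**`unprojectedDense_monicCurve_rationalFibre`** (any monic irreducible `F`, place
`(s^{-k}, Φ(s)s^{-M})`, direction `Re(Φ(0)z^M) ≠ 0`) and **`unprojectedDense_cyclicCover_rationalFibre`**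
(`x₁^k = P(x₀)`, `k ≥ 3`, `P` monic with a simple root: NO further hypothesis — a non-real sheet always
has a good direction, file XXXIV).  So over the cyclic covers with `k ≥ 3` the graph of EVERY nonzero
rational function `f ∈ ℂ(C)` carries Zariski-dense exponential points.  (`k = 2`: a non-constant
`f ∈ ℂ(C)` may be finite and nonzero at both places at infinity — then the flat route of file LI
needs the τ-analysis; OPEN, O86.)  Decided instances of an OPEN question (Mantova–Masser, PLMS 2024
§1 p. 5); EC(3,2) OPEN; NOT Schanuel's conjecture (neither used nor implied); EAC ⇏ SC.
-/

noncomputable section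

open Filter Topology Set Complex Polynomial
open Literature.NumberTheory.Transcendental Literature.ModelTheory.Zilber
open Literature.ModelTheory.ExponentialFields

set_option linter.dupNamespace false

namespace Summit.Schanuel.Schanuel.Theorems

/-! ## Part A. Rational fibres along a good place of a monic curve -/

/-- **Rational fibres over a monic irreducible plane curve along a good place: dense.**  `F` monic
irreducible of positive `x₁`-degree; a place `x₀ = s^{-k}`, `x₁ = Φ(s)s^{-M}` (`k, M ≥ 1`) with a good
direction; `R, Q ∈ ℂ[x₀, x₁]` each nonzero somewhere on the curve; `S` irreducible closed of
dimension `≤ 2` containing every point `(x₀, x₁, R(x)/Q(x), e^{x₁})` with `F(x) = 0`, `Q(x) ≠ 0`.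
Then `S` has Zariski-dense exponential points. [cite: MantovaMasser2023, §1 Further remarks, p. 5
(the question, open in general)] (new) -/
theorem unprojectedDense_monicCurve_rationalFibre (F : ℂ[X][X]) (hFm : F.Monic)
    (hFirr : Irreducible F) (hn : 1 ≤ F.natDegree) {k M : ℕ} (hk : 1 ≤ k) (hM : 1 ≤ M) {Φ : ℂ → ℂ}
    (hΦan : AnalyticAt ℂ Φ 0)
    (hplace : ∀ᶠ s in 𝓝[≠] (0 : ℂ),
      (F.map (Polynomial.evalRingHom (s ^ k)⁻¹)).eval (Φ s * (s ^ M)⁻¹) = 0)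
    (hdir : ∃ z : ℂ, z ^ k = 2 * Real.pi * I ∧ (Φ 0 * z ^ M).re ≠ 0)
    (R Q : MvPolynomial (Fin 2) ℂ)
    (hR : ∃ x y : ℂ, (F.map (Polynomial.evalRingHom x)).eval y = 0 ∧ MvPolynomial.eval ![x, y] R ≠ 0)
    (hQ : ∃ x y : ℂ, (F.map (Polynomial.evalRingHom x)).eval y = 0 ∧ MvPolynomial.eval ![x, y] Q ≠ 0)
    {S : Set (Fin 2 ⊕ Fin 2 → ℂ)} (hS : IsIrreducibleClosed ℂ S) (hdim : zariskiDim ℂ S ≤ (2 : ℕ))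
    (hsub : ∀ x y : ℂ, (F.map (Polynomial.evalRingHom x)).eval y = 0 →
      MvPolynomial.eval ![x, y] Q ≠ 0 →
      (Sum.elim ![x, y] ![MvPolynomial.eval ![x, y] R / MvPolynomial.eval ![x, y] Q, Complex.exp y] :
        Fin 2 ⊕ Fin 2 → ℂ) ∈ S) :
    UnprojectedDense S := by
  classical
  -- rows of `R` and `Q`
  obtain ⟨GR, hGRdeg, hGRev⟩ := exists_rows_reduction_monic F hFm hn R
  obtain ⟨GQ, hGQdeg, hGQev⟩ := exists_rows_reduction_monic F hFm hn Q
  have hGR0 : GR ≠ 0 := by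
    intro hG
    obtain ⟨x, y, hxy, hne⟩ := hR
    apply hne
    rw [hGRev x y hxy, hG, Polynomial.map_zero, Polynomial.eval_zero]
  have hGQ0 : GQ ≠ 0 := by
    intro hG
    obtain ⟨x, y, hxy, hne⟩ := hQ
    apply hne
    rw [hGQev x y hxy, hG, Polynomial.map_zero, Polynomial.eval_zero]
  obtain ⟨ψR, LR, hψRan, hψR0, hfR⟩ := exists_place_normalForm F hFm hFirr GR hGR0 hGRdeg hk M hΦan hplace
  obtain ⟨ψQ, LQ, hψQan, hψQ0, hfQ⟩ := exists_place_normalForm F hFm hFirr GQ hGQ0 hGQdeg hk M hΦan hplace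
  -- the quotient
  set ψ : ℂ → ℂ := fun s => ψR s / ψQ s with hψ
  have hψan : AnalyticAt ℂ ψ 0 := hψRan.div hψQan hψQ0
  have hψ0 : ψ 0 ≠ 0 := div_ne_zero hψR0 hψQ0
  have hψQne : ∀ᶠ s in 𝓝 (0 : ℂ), ψQ s ≠ 0 := hψQan.continuousAt.eventually_ne hψQ0
  refine unprojectedDense_branch_poleFibre_of_exists_direction hS hdim hk hM (LR - LQ) hψan hψ0 hΦan
    hdir ?_
  filter_upwards [hplace, hfR, hfQ, eventually_nhdsWithin_of_eventually_nhds hψQne, self_mem_nhdsWithin]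
    with s hs hRs hQs hψQs hs0
  have hs0' : s ≠ 0 := hs0
  have hQne : MvPolynomial.eval ![(s ^ k)⁻¹, Φ s * (s ^ M)⁻¹] Q ≠ 0 := by
    rw [hGQev _ _ hs, hQs]
    exact mul_ne_zero hψQs (zpow_ne_zero _ hs0')
  have hpt := hsub _ _ hs hQne
  have hval : MvPolynomial.eval ![(s ^ k)⁻¹, Φ s * (s ^ M)⁻¹] R /
      MvPolynomial.eval ![(s ^ k)⁻¹, Φ s * (s ^ M)⁻¹] Q = ψ s * s ^ (LR - LQ) := by
    rw [hGRev _ _ hs, hGQev _ _ hs, hRs, hQs, hψ, zpow_sub₀ hs0']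
    simp only
    field_simp
  rw [hval] at hpt
  exact hpt

/-! ## Part B. Every cyclic cover `x₁^k = P(x₀)`, `k ≥ 3` -/

section CyclicCover

variable (P : ℂ[X])

/-- **Rational fibres over `x₁^k = P(x₀)`, `k ≥ 3`: dense, no further hypothesis.**  `P` monic of
degree `≥ 1` with a simple root; `R, Q ∈ ℂ[x₀, x₁]` each nonzero somewhere on the curve; `S`
irreducible closed of dimension `≤ 2` containing the graph of `R/Q` over the curve off the poles.
Then `S` has Zariski-dense exponential points (a non-real sheet, file XXXIV; any order `L`, file
XXXII). [cite: MantovaMasser2023, §1 Further remarks, p. 5 (the question, open in general)] (new) -/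
theorem unprojectedDense_cyclicCover_rationalFibre {k : ℕ} (hk : 3 ≤ k) (hP : P.Monic)
    (hM : 1 ≤ P.natDegree) {r : ℂ} (hr : P.IsRoot r) (hr1 : P.derivative.eval r ≠ 0)
    (R Q : MvPolynomial (Fin 2) ℂ)
    (hR : ∃ x : Fin 2 → ℂ, MvPolynomial.eval x
        (MvPolynomial.X 1 ^ k - Polynomial.aeval (MvPolynomial.X 0 : MvPolynomial (Fin 2) ℂ) P) = 0 ∧
      MvPolynomial.eval x R ≠ 0)
    (hQ : ∃ x : Fin 2 → ℂ, MvPolynomial.eval x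
        (MvPolynomial.X 1 ^ k - Polynomial.aeval (MvPolynomial.X 0 : MvPolynomial (Fin 2) ℂ) P) = 0 ∧
      MvPolynomial.eval x Q ≠ 0)
    {S : Set (Fin 2 ⊕ Fin 2 → ℂ)} (hS : IsIrreducibleClosed ℂ S) (hdim : zariskiDim ℂ S ≤ (2 : ℕ))
    (hsub : ∀ x y : ℂ, y ^ k = P.eval x → MvPolynomial.eval ![x, y] Q ≠ 0 →
      (Sum.elim ![x, y] ![MvPolynomial.eval ![x, y] R / MvPolynomial.eval ![x, y] Q, Complex.exp y] :
        Fin 2 ⊕ Fin 2 → ℂ) ∈ S) :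
    UnprojectedDense S := by
  classical
  set M : ℕ := P.natDegree with hMdef
  have hk1 : 1 ≤ k := by omega
  obtain ⟨GR, hGRdeg, hGRev⟩ := exists_rows_reduction P hk1 R
  obtain ⟨GQ, hGQdeg, hGQev⟩ := exists_rows_reduction P hk1 Q
  have hpt_rows : ∀ {G : ℂ[X][X]} {T : MvPolynomial (Fin 2) ℂ},
      (∀ x y : ℂ, y ^ k = P.eval x →
        MvPolynomial.eval ![x, y] T = (G.map (Polynomial.evalRingHom x)).eval y) →
      (∃ x : Fin 2 → ℂ, MvPolynomial.eval x
        (MvPolynomial.X 1 ^ k - Polynomial.aeval (MvPolynomial.X 0 : MvPolynomial (Fin 2) ℂ) P) = 0 ∧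
        MvPolynomial.eval x T ≠ 0) → G ≠ 0 := by
    intro G T hGev hT hG
    obtain ⟨x, hxC, hxT⟩ := hT
    apply hxT
    have hy : x 1 ^ k = P.eval (x 0) := by
      rw [eval_superellipticMv] at hxC
      exact sub_eq_zero.1 hxC
    have hx : x = ![x 0, x 1] := by
      funext i
      fin_cases i <;> simp
    rw [hx, hGev _ _ hy, hG, Polynomial.map_zero, Polynomial.eval_zero]
  have hGR0 : GR ≠ 0 := hpt_rows hGRev hR
  have hGQ0 : GQ ≠ 0 := hpt_rows hGQev hQ
  obtain ⟨ζ, z, hζ, hz, hre⟩ := exists_sheet_direction hk M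
  obtain ⟨Φ, hΦan, hΦ0, hsheet⟩ := superelliptic_sheet_facts P hk1 hP hζ
  obtain ⟨ψR, LR, hψRan, hψR0, hfR⟩ :=
    exists_cyclicSheet_normalForm P hk1 hr hr1 GR hGR0 hGRdeg hΦan hsheet
  obtain ⟨ψQ, LQ, hψQan, hψQ0, hfQ⟩ :=
    exists_cyclicSheet_normalForm P hk1 hr hr1 GQ hGQ0 hGQdeg hΦan hsheet
  set ψ : ℂ → ℂ := fun s => ψR s / ψQ s with hψ
  have hψan : AnalyticAt ℂ ψ 0 := hψRan.div hψQan hψQ0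
  have hψ0 : ψ 0 ≠ 0 := div_ne_zero hψR0 hψQ0
  have hψQne : ∀ᶠ s in 𝓝 (0 : ℂ), ψQ s ≠ 0 := hψQan.continuousAt.eventually_ne hψQ0
  refine unprojectedDense_branch_poleFibre_of_exists_direction hS hdim hk1 hM (LR - LQ) hψan hψ0 hΦan
    ⟨z, hz, by rw [hΦ0]; exact hre⟩ ?_
  filter_upwards [hsheet, hfR, hfQ, eventually_nhdsWithin_of_eventually_nhds hψQne, self_mem_nhdsWithin]
    with s hs hRs hQs hψQs hs0
  have hs0' : s ≠ 0 := hs0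
  have hy : (Φ s * (s ^ M)⁻¹) ^ k = P.eval (s ^ k)⁻¹ := sub_eq_zero.1 hs
  have hQne : MvPolynomial.eval ![(s ^ k)⁻¹, Φ s * (s ^ M)⁻¹] Q ≠ 0 := by
    rw [hGQev _ _ hy, hQs]
    exact mul_ne_zero hψQs (zpow_ne_zero _ hs0')
  have hpt := hsub _ _ hy hQne
  have hval : MvPolynomial.eval ![(s ^ k)⁻¹, Φ s * (s ^ M)⁻¹] R /
      MvPolynomial.eval ![(s ^ k)⁻¹, Φ s * (s ^ M)⁻¹] Q = ψ s * s ^ (LR - LQ) := by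
    rw [hGRev _ _ hy, hGQev _ _ hy, hRs, hQs, hψ, zpow_sub₀ hs0']
    simp only
    field_simp
  rw [hval] at hpt
  exact hpt

end CyclicCover

end Summit.Schanuel.Schanuel.Theorems

end
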